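import Literature.MathematicalPhysics.QuantumFieldTheory.Balaban1983to89.Node00.Carriers3
import Literature.MathematicalPhysics.QuantumFieldTheory.Balaban1983to89.Node00.Satisfiable
import Literature.MathematicalPhysics.QuantumFieldTheory.Balaban1983to89.Node00.WorldFrame
import Literature.MathematicalPhysics.QuantumFieldTheory.Balaban1983to89.B10Eq29TubeLine

/-!
# `Balaban1983to89.B14NodeKnitFrame` — YM-DAG node N11 · [Balaban1988Convergent] CMP **119** (1988) 243–285, Thm 1 p. 262:
# the p. 262-remark currency of the knit («𝐑T transforms the space with the index k into the space with the index k+1») and the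
# LOCATED TYPING OBSTRUCTION — the Stage-3 frame of record, EVEN WITH the 𝐑-leaf and every non-construction antecedent of the node,
# admits objects at which N11's content fails (kernel form of R422 for N11: the construction pin is where the node's content enters)

statement-level bookkeeping over published theorems with citation tags; kernel-checked witnesses; nothing here is a claim about the
Yang–Mills mass gap.

CITATION HEADER (lean-in-tree rule).  Source: T. Bałaban, *Convergent renormalization expansions for lattice gauge theories*, Commun.
Math. Phys. **119**, 243–285 (1988) [Balaban1988Convergent] (cell paper B14 = «[III]»).  Seat `pub-ymgap-dag-n11-a` (YM-PLAN Track A,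
D-0062, KNIT-BY-NAME seat of N11), companion of `…B14NodeKnit` (p408840: the knit `b14_main_of_thmP245I` — N11 from the 𝐑-leaf, a
(0.2) trajectory and the pins (P1)–(P3), modulo the start (S0) and the Theorem of p. 245 (S1)).  BY NAME and UNCHANGED: `…Dag.B14_main`,
`…DagBinding.leavesP ∕ ROpLeaf ∕ PrintedCarriers14R`, `…StepInhabited` (`Step.DensityRGI.MapsSpaces`, `inSpace_all`), `…Node00.Carriers3`
(`IsWorldOfRecord₃`, `isWorldOfRecord₃_of_up`, `b4∕b5∕b7_main_of_isWorldOfRecord₃`; `Stage1Params.exists_admissible`),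
`…Node00.Satisfiable` (`nonempty_printedCarriersR ∕ 9X ∕ 11 ∕ 15`, `nonempty_params`), `…Node00.WorldFrame` (`b14_main_iff_of_leaves`,
`b14_main_of_trivial_sect2Form`), `…UnitaryModel` (instances on `U(1)`).

WHAT THIS FILE PROVES (0 `sorry`, 0 `def`, standard axioms).
§1 `b14_main_of_mapsSpaces` — N11 in the currency of the SECOND REMARK of p. 262 (verbatim: *«For a given index k we introduce the space of all
   densities satisfying the conditions of the inductive assumption. The theorem states that the operation 𝐑T transforms the space with the
   index k into the space with the index k+1.»*): pins (P2′) a (0.2) trajectory `D` on the carrier's lattices, (P3) `V.S k (D.ρ k) → Sect2Form k`;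
   slots (S0) the start and (S1′) `Step.DensityRGI.MapsSpaces D V.S P.K` GIVEN the in-edges AND the 𝐑-leaf (the composite 𝐑T is one map here, so
   the leaf is an antecedent of the slot; `B14.mapsSpaces_of_thmP245SpacesI` is how (S1′) splits into the T-half and the assumed 𝐑); kernel =
   `Step.DensityRGI.inSpace_all`.  Count-neutral.
§2 **`stage3Frame_admits_nonN11Content`** — THE OBSTRUCTION: there is a binding world of record, Stage 3 (`Node00.IsWorldOfRecord₃`, admissible
   parameters with `D = 4` built from `Stage1Params.exists_admissible` exactly as `Node00.N24Glue.N24_exists_stage3Params` does, the N-binding over `carriers₃ θ X`), with `0 < γ`, and a run `P` (`K = 0`) at which the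
   𝐑-leaf HOLDS, the interval hypothesis HOLDS, the small-field inductive assumptions and the flow control (2.6) HOLD, and yet `densitiesDescribed`
   FAILS — the construction being the junk one with `Sect2Form ≡ False` (the frame leaves `w.C` free) and the 𝐑-carrier the degenerate `V` with
   `S ≡ Scorr ≡ True` (so `ROpLeaf V` is trivially inhabited).  Corollaries: `not_forall_stage3_n11Content` (the right-hand side of
   `Node00.WorldFrame.b14_main_iff_of_leaves` — «N11 GIVEN its carrier leaves» — is NOT a theorem over the Stage-3 frame) and
   `stage3Frame_nonN11_of_leaves` (at that world N04's `b7` holds by `b7_main_of_isWorldOfRecord₃`; so if the remaining carrier leaves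
   `b8 b9 b10 b11` hold there, `Dag.B14_main (leavesP w P)` itself fails).  READING: a `stub_N11` typed over a Stage-≤ 3 (indeed ≤ 4) record
   predicate is a refuter's target; N11's content enters ONLY through the Stage-5 pin of the construction (`Sect2Form`) and of `V.S ∕ V.Scorr ∕ V.R`
   — the knit's (P3) is load-bearing, and its mirror image is `Node00.WorldFrame.b14_main_of_trivial_sect2Form` (with `Sect2Form ≡ True` the node
   holds with no content).  This is the per-node form, for N11, of the dagwriter's cluster-level `not_paperClusters_over_stage3Frame` and of
   `Node00.N24Glue.N24_frame₃_admits_nonB`.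

HONEST FRAMING.  Bookkeeping and typing hygiene only: a DEGENERATE witness (junk construction, `U(1) ⊂ M₁(ℂ)` carrier with identity «𝐑»), no
object of Bałaban's; nothing of [Balaban1988Convergent] is asserted or refuted — the located negative concerns OUR frame, not the paper.
Count-neutral.  One finite four-torus programme; nothing continuum ∕ ℝ⁴ ∕ OS ∕ mass gap ∕ Clay.

EDITION 2026-08-29 (director-ym №268 (4), SECOND RING of the record-abelian repair FLAG №14): the ∃-witness literal of `stage3Frame_admits_nonN11Content` re-keyed from the scalar placeholder `𝔸 := ℂ` to the record carrier `𝔸 := Matrix (Fin 2) (Fin 2) ℂ` (C⋆-structure `B10Eq29TubeLine.cstarAlgebraMatrix 2`, the carrier of `Node00.stage3OfRecord₁₂` since the FLAG №14 edition of `Node00.Record12Numerics`); the proofs are carrier-blind and NO statement changes (none of them exposes `𝔸`); one import added (`B10Eq29TubeLine`, cycle-free); count-neutral bookkeeping, nothing continuum ∕ OS ∕ mass-gap.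
-/

noncomputable section

namespace Literature.MathematicalPhysics.QuantumFieldTheory.Balaban1983to89.B14NodeKnitFrame

open DagBinding Node00

/-! ## §1. N11 in the currency of the second remark of p. 262 (`Step.DensityRGI.MapsSpaces`) -/

section MapsSpaces

variable (w : WorldP) (P : B12.RunParams) (V : PrintedCarriers14R) {av : ∀ j, Averaging V.P j V.G}

/-- **N11 from «𝐑T maps the index-k space into the index-(k+1) space»** ([Balaban1988Convergent] p. 262, second remark after Thm 1, for the
composite 𝐑T of (0.2)): a (0.2) trajectory `D` on the carrier's lattices, the reading (P3) `V.S k (D.ρ k) → Sect2Form k`, the start (S0), and the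
slot `Step.DensityRGI.MapsSpaces D V.S P.K` GIVEN the node's in-edges and its 𝐑-leaf give `Dag.B14_main (leavesP w P)` by
`Step.DensityRGI.inSpace_all`.  In this currency the 𝐑-leaf is an antecedent of the slot (the T-half ∕ 𝐑-half split is
`B14.mapsSpaces_of_thmP245SpacesI`; the knit proper, with the leaf CONSUMED, is `B14NodeKnit.b14_main_of_thmP245I`).  Count-neutral slot
landing. [cite: Balaban1988Convergent, Thm 1 and second remark p.262] -/
theorem b14_main_of_mapsSpaces (D : Step.DensityRGI V.P V.G av)
    (hS : ∀ k, k ≤ P.K → V.S k (D.ρ k) → (w.C P).Sect2Form k)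
    (h0 : (leavesP w P).smallCouplings → V.S 0 (D.ρ 0))
    (hM : (leavesP w P).b7 → (leavesP w P).b8 → (leavesP w P).b9 → (leavesP w P).b10 → (leavesP w P).b11 →
      (leavesP w P).smallCouplings → (leavesP w P).smallFieldInductive → (leavesP w P).flowControl →
        (leavesP w P).rOperation → D.MapsSpaces V.S P.K) :
    Dag.B14_main (leavesP w P) := by
  intro h7 h8 h9 h10 h11 hsf hfc hrop hsc k hk
  exact hS k hk (D.inSpace_all V.S P.K (h0 hsc) (hM h7 h8 h9 h10 h11 hsc (hsf hsc) (hfc hsc) hrop) k hk)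

end MapsSpaces

/-! ## §2. The typing obstruction: the Stage-3 frame, with the 𝐑-leaf and every non-construction antecedent, does not pin N11 -/

/-- **THE STAGE-3 FRAME ADMITS NON-N11 OBJECTS.**  There is a binding world of record, Stage 3 (admissible `θ`, `D = 4`, built as in `Node00.N24Glue.N24_exists_stage3Params`; N-binding over
`carriers₃ θ X`; `0 < γ`), and a run (`K = 0`, `g₀ = 1`) at which: the 𝐑-leaf `(leavesP w P).rOperation` HOLDS (degenerate carrier `V`,
`S ≡ Scorr ≡ True`, identity «𝐑»), the interval hypothesis HOLDS (`g ≡ 1 ≤ γ = 1`), the small-field inductive assumptions HOLD (`IndAss ≡ True`),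
the flow control (2.6) HOLDS (no pair `m < n ≤ 0`), and `densitiesDescribed` FAILS (`Sect2Form ≡ False`: the frame leaves the construction
`w.C` free).  Kernel form, for N11, of «NEVER closed over the un-pinned Stage-2∕3 frame» (R422).  Degenerate witness; nothing of the paper
asserted or refuted. [cite: Balaban1988Convergent, Thm 1 p.262 (what the frame does NOT pin; bookkeeping witness)] -/
theorem stage3Frame_admits_nonN11Content :
    ∃ w : WorldP, IsWorldOfRecord₃ w ∧ 0 < w.γ ∧ ∃ P : B12.RunParams,
      (leavesP w P).rOperation ∧ (leavesP w P).smallCouplings ∧ (∀ k, k ≤ P.K → (w.C P).IndAss k) ∧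
        B14.FlowIneq26 (w.C P).flow.g w.βup w.β₀ P.K ∧ ¬ (leavesP w P).densitiesDescribed := by
  -- admissible Stage-3 parameters (the construction of `Node00.N24Glue.N24_exists_stage3Params`, inlined: coefficient algebra `M₂(ℂ)` — the record carrier `Matrix (Fin 2) (Fin 2) ℂ` (EDITION director-ym №268 (4), second ring: formerly the scalar placeholder `ℂ`),
  -- `d₆ = D − 1`, `ℓ₆ = L − 1`, weight band `b₀ = b₁ = 1`, rate `δ₀ = 2/L`)
  obtain ⟨θ₁, hθ₁, hD⟩ := Stage1Params.exists_admissible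
  have hL : 1 < θ₁.L := θ₁.hL.2
  let θ : Stage3Params :=
    { θ₁ with
      𝔸 := Matrix (Fin 2) (Fin 2) ℂ, instCStar := B10Eq29TubeLine.cstarAlgebraMatrix 2, instNontrivial := inferInstance, d₆ := θ₁.D - 1, ℓ₆ := θ₁.L - 1, hd₆ := (by omega), hℓ₆ := (by omega), b₀ := 1, b₁ := 1,
      hb := ⟨one_pos, le_rfl⟩, δ₀ := 2 / (((θ₁.L - 1 : ℕ) : ℝ) + 1), hδ₀ := ⟨(by positivity), le_rfl⟩ }
  have hθ : θ.toStage1Params.Admissible := hθ₁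
  obtain ⟨X⟩ := nonempty_printedCarriersR
  obtain ⟨Y⟩ := nonempty_printedCarriers9X
  obtain ⟨Z⟩ := nonempty_printedCarriers11
  obtain ⟨W⟩ := nonempty_printedCarriers15
  obtain ⟨Pₛ⟩ := nonempty_params
  let V : PrintedCarriers14R :=
    { P := Pₛ, G := ↥(Matrix.unitaryGroup (Fin 1) ℂ), instGG := inferInstance, instMS := inferInstance, instHD := inferInstance,
      K := 0, R := fun _ ρ => ρ, Scorr := fun _ _ => True, S := fun _ _ => True }
  let C : B16.Construction := fun _ =>
    { flow := { g := fun _ => 1, β := fun _ _ => 0 }, Cfg := fun _ => PUnit, dom := fun _ => Set.univ, effAction := fun _ _ => 0,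
      wilsonBG := fun _ _ => 0, Ek := fun _ _ => 0, numSites := fun _ => 1, Repr := fun _ => True, IndAss := fun _ => True,
      ρ := fun _ _ => 1, χ := fun _ _ => 1, Sect2Form := fun _ => False }
  refine ⟨⟨C, 1, fun _ => 0, fun _ => 0, 1, 1, one_pos, 1, one_pos, 2, one_lt_two, 1,
      fun _ => Upstream.ofPrintedAllXPN (carriers₃ θ X) Y Z V W⟩,
    isWorldOfRecord₃_of_up θ hθ X Y Z V W _ rfl, one_pos, ⟨0, 0, 1⟩, ?_, ?_, ?_, ?_, ?_⟩
  · show ROpLeaf V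
    intro k hk
    exact absurd hk (Nat.not_lt_zero k)
  · intro k _
    exact ⟨one_pos, le_rfl⟩
  · intro _ _
    trivial
  · intro m n hmn hn
    exact absurd (lt_of_lt_of_le hmn hn) (Nat.not_lt_zero m)
  · intro h
    exact h 0 le_rfl

/-- **«N11 GIVEN ITS CARRIER LEAVES» IS NOT A THEOREM OVER THE STAGE-3 FRAME**: the right-hand side of `Node00.WorldFrame.b14_main_iff_of_leaves`
(the node once `b7 … b11` hold: `(sC → IndAss) → (sC → (2.6)) → (rOperation → (sC → ∀ k ≤ K, Sect2Form k))`) fails at the witness of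
`stage3Frame_admits_nonN11Content`.  So a `stub_N11` must be typed over a record predicate pinning the construction (Stage 5) — the knit's pin
(P3) `V.S k (ρ_k) → Sect2Form k` is where the content enters (mirror image: `Node00.WorldFrame.b14_main_of_trivial_sect2Form`).
[cite: Balaban1988Convergent, Thm 1 p.262 (typing hygiene; bookkeeping)] -/
theorem not_forall_stage3_n11Content :
    ¬ ∀ w : WorldP, IsWorldOfRecord₃ w → ∀ P : B12.RunParams,
      (((w.C P).flow.InInterval w.γ P.K → ∀ k, k ≤ P.K → (w.C P).IndAss k) →
        ((w.C P).flow.InInterval w.γ P.K → B14.FlowIneq26 (w.C P).flow.g w.βup w.β₀ P.K) →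
          ((w.up P).rOperation → ((w.C P).flow.InInterval w.γ P.K → ∀ k, k ≤ P.K → (w.C P).Sect2Form k))) := by
  intro h
  obtain ⟨w, hw, -, P, hrop, hsc, hia, hfc, hnd⟩ := stage3Frame_admits_nonN11Content
  exact hnd (h w hw P (fun _ => hia) (fun _ => hfc) hrop hsc)

/-- **… hence N11 ITSELF fails there as soon as the remaining carrier leaves hold**: at the witness world N04's leaf `b7` is a tree theorem
(`Node00.b7_main_of_isWorldOfRecord₃` with `b4 ∕ b5_main_of_isWorldOfRecord₃`), so `b8 ∧ b9 ∧ b10 ∧ b11` at that run would refute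
`Dag.B14_main (leavesP w P)` — the node statement is protected from this junk only by pinning the construction, not by its in-edges.
[cite: Balaban1988Convergent, Thm 1 p.262 (typing hygiene; bookkeeping)] -/
theorem stage3Frame_nonN11_of_leaves :
    ∃ w : WorldP, IsWorldOfRecord₃ w ∧ ∃ P : B12.RunParams,
      ((w.up P).b8 ∧ (w.up P).b9 ∧ (w.up P).b10 ∧ (w.up P).b11 → ¬ Dag.B14_main (leavesP w P)) := by
  obtain ⟨w, hw, -, P, hrop, hsc, hia, hfc, hnd⟩ := stage3Frame_admits_nonN11Content
  refine ⟨w, hw, P, fun ⟨h8, h9, h10, h11⟩ hN => hnd ?_⟩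
  have h4 : (leavesP w P).b4 := b4_main_of_isWorldOfRecord₃ w hw P
  have h5 : (leavesP w P).b5 := b5_main_of_isWorldOfRecord₃ w hw P h4
  have h7 : (leavesP w P).b7 := b7_main_of_isWorldOfRecord₃ w hw P h5
  exact hN h7 h8 h9 h10 h11 (fun _ => hia) (fun _ => hfc) hrop hsc

end Literature.MathematicalPhysics.QuantumFieldTheory.Balaban1983to89.B14NodeKnitFrame

end
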